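import Literature.Probability.LatticeModels.DobrushinShlosmanUniquenessBulk
import HarnessLib

/-!
# The Dobrushin–Shlosman window comparison under the averaged condition: uniqueness in a region with
# frozen exterior, for test observables reading the free region only

Topic `Literature/Probability/LatticeModels`; theorems only (no definitions, no named facts).

Companion of `DobrushinShlosmanUniquenessBulk.lean`. Its frozen-region corollaries
(`integral_eq_of_dlrOn_window_bulk`, `measure_eq_of_dlrOn_window_bulk`) ask the exhaustion hypothesis for
EVERY finite test set `Δ ⊆ V` (`Δ ⊆ Λ ⊆ W`), which is only satisfiable for the full region `W = V`
(Dobrushin–Shlosman's uniqueness theorem under `C_V`). For a PROPER free region `W` (a slab with frozen faces,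
a half-space, a box with a fixed boundary condition — Georgii 2011, Thm. 8.20 «no phase transition in a
subvolume») the two measures are concentrated on `{σ = ζ off W}`, so a test observable may first have its
exterior coordinates frozen to `ζ` (almost surely nothing changes), after which it reads only `Δ ∩ W`; the
exhaustion is then needed for finite `Δ ⊆ W` only. This file records that form:

* `integral_eq_of_frozen_dlr_window_bulk`, `measure_eq_of_frozen_dlr_window_bulk` — as the tree's
  corollaries, with the exhaustion hypothesis restricted to finite `Δ ⊆ W`.

References: R. L. Dobrushin, S. B. Shlosman (1985), Thm. 1; H.-O. Georgii, *Gibbs Measures and Phase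
Transitions* (2011), Thm. 8.20; F. Martinelli, LNM 1717 (1999), Thm. 2.4.
-/

noncomputable section

open MeasureTheory ProbabilityTheory Finset Function
open Literature.Probability.LatticeModels.DobrushinMetric (IsLipBound integrable_of_abs_le'
  abs_sub_le_mul_sum_of_dependsOn measure_eq_of_forall_integral_eq_of_isLipBound)

namespace Literature.Probability.LatticeModels.DobrushinShlosman

variable {V S : Type*} [MeasurableSpace S]

/-! ### Small measure-theoretic helpers -/

/-- Two averages, under two probability measures, of a bounded measurable function whose oscillation is
`≤ A` between configurations satisfying two ALMOST SURE constraints differ by at most `A`. [folklore] -/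
private theorem abs_integral_sub_integral_le_of_osc_ae {μ ν : Measure (V → S)} [IsProbabilityMeasure μ]
    [IsProbabilityMeasure ν] {h : (V → S) → ℝ} (hm : Measurable h) {B : ℝ} (hB : ∀ σ, |h σ| ≤ B)
    {P Q : (V → S) → Prop} (hP : ∀ᵐ σ ∂μ, P σ) (hQ : ∀ᵐ τ ∂ν, Q τ)
    {A : ℝ} (hosc : ∀ σ τ, P σ → Q τ → |h σ - h τ| ≤ A) :
    |(∫ σ, h σ ∂μ) - ∫ τ, h τ ∂ν| ≤ A := by
  -- adapted from `DobrushinShlosmanUniqueness` (private `abs_integral_sub_integral_le_of_osc'`), a.e. form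
  have hiμ : Integrable h μ := integrable_of_abs_le' hm hB
  have hiν : Integrable h ν := integrable_of_abs_le' hm hB
  have hpt : ∀ σ, P σ → |h σ - ∫ τ, h τ ∂ν| ≤ A := fun σ hσ => by
    have e : h σ - ∫ τ, h τ ∂ν = ∫ τ, (h σ - h τ) ∂ν := by
      rw [integral_sub (integrable_const _) hiν, integral_const, smul_eq_mul, probReal_univ, one_mul]
    rw [e]
    calc |∫ τ, (h σ - h τ) ∂ν| ≤ ∫ τ, |h σ - h τ| ∂ν := abs_integral_le_integral_abs
      _ ≤ ∫ _τ, A ∂ν := by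
          refine integral_mono_ae ((integrable_const _).sub hiν).abs (integrable_const A) ?_
          filter_upwards [hQ] with τ hτ using hosc σ τ hσ hτ
      _ = A := by simp
  have e : (∫ σ, h σ ∂μ) - ∫ τ, h τ ∂ν = ∫ σ, (h σ - ∫ τ, h τ ∂ν) ∂μ := by
    rw [integral_sub hiμ (integrable_const _), integral_const, smul_eq_mul, probReal_univ, one_mul]
  rw [e]
  calc |∫ σ, (h σ - ∫ τ, h τ ∂ν) ∂μ| ≤ ∫ σ, |h σ - ∫ τ, h τ ∂ν| ∂μ := abs_integral_le_integral_abs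
    _ ≤ ∫ _σ, A ∂μ := by
        refine integral_mono_ae (hiμ.sub (integrable_const _)).abs (integrable_const A) ?_
        filter_upwards [hP] with σ hσ using hpt σ hσ
    _ = A := by simp

/-- **One DLR equation, for observables** (Georgii 2011, Remark 1.24): if the probability measure `μ`
satisfies `∫ γ_Λ(A|η) dμ(η) = μ(A)` for ONE finite volume `Λ`, then `∫ (∫ f dγ_Λ(·|η)) dμ(η) = ∫ f dμ`
for every `μ`-integrable `f`. [cite: Georgii2011, Rem. 1.24] -/
private theorem integral_integral_eq_of_dlr' {γ : Specification V S} (hγ : IsSpecification γ)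
    {μ : Measure (V → S)} [IsProbabilityMeasure μ] (Λ : Finset V)
    (hDLR : ∀ A : Set (V → S), MeasurableSet A → ∫⁻ η, γ Λ η A ∂μ = μ A)
    {f : (V → S) → ℝ} (hf : Integrable f μ) :
    ∫ η, ∫ σ, f σ ∂(γ Λ η) ∂μ = ∫ σ, f σ ∂μ := by
  -- adapted from `Literature.MathematicalPhysics.QuantumLattice.DobrushinFrozen.integral_integral_eq_of_dlr`
  let κ : Kernel (V → S) (V → S) := ⟨γ Λ, hγ.measurable_fun Λ⟩
  have hbind : μ.bind (γ Λ) = μ := by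
    ext A hA
    rw [Measure.bind_apply hA (hγ.measurable_fun Λ).aemeasurable]
    exact hDLR A hA
  have hcomp : (κ ∘ₖ Kernel.const Unit μ) () = μ := by
    rw [Kernel.comp_apply, Kernel.const_apply]
    exact hbind
  have hfi : Integrable f ((κ ∘ₖ Kernel.const Unit μ) ()) := by rwa [hcomp]
  have key := Kernel.integral_comp hfi
  rw [hcomp, Kernel.const_apply] at key
  exact key.symm

/-! ### Uniqueness in a region with frozen exterior -/

/-- **Two solutions of the DLR system on a region `W` with frozen exterior agree on bounded local
Lipschitz observables, under the averaged window condition** (Dobrushin–Shlosman 1985 Thm. 1 / Georgii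
2011 Thm. 8.20, window form): let `μ, ν` be probability measures concentrated on `{σ = ζ off W}` that
satisfy the DLR equations for the kernels `γ_Λ`, `Λ ⊆ W` finite; suppose every finite `Δ` and depth `L₀`
(`Δ ⊆ W`) admit a finite `Λ ⊆ W`, `Δ ⊆ Λ`, and a profile `ℓ ≥ L₀` on `Δ`, dropping by at most one along the
support of `K`, whose positive-profile windows have centre and window in `Λ` and read the exterior of `Λ` only
in the frozen set `Wᶜ`. Then `∫ F dμ = ∫ F dν` for every bounded measurable local `F` with a site-Lipschitz
vector (freeze the exterior coordinates of `F` to `ζ`, which changes nothing almost surely; then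
`μ F − ν F = ∫∫ [γ_Λ F(ω) − γ_Λ F(η)] dμ(ω) dν(η)` with `ω = ζ = η` off `W` almost surely, and
`abs_integral_sub_integral_le_of_window_bulk`). [cite: DobrushinShlosman1985, Theorem 1] -/
theorem integral_eq_of_frozen_dlr_window_bulk [DecidableEq V] {γ : Specification V S}
    (hγ : IsSpecification γ)
    {r : S → S → ℝ} {R : ℝ} (hr0 : ∀ a b, 0 ≤ r a b) (hrR : ∀ a b, r a b ≤ R) (hR : 0 ≤ R)
    {win nbhd : V → Finset V} {K : V → V → V → ℝ} (hK0 : ∀ c y x, 0 ≤ K c y x)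
    (hKsupp : ∀ c y x, K c y x ≠ 0 → y ∈ nbhd c)
    (hcontract : ∀ (c y : V), y ∉ win c → ∀ (ω η : V → S), (∀ v, v ≠ y → ω v = η v) →
      ∀ (f : (V → S) → ℝ) (δ : V → ℝ), Measurable f → (∃ B, ∀ σ, |f σ| ≤ B) →
        DependsOn f (win c : Set V) → (∀ x, 0 ≤ δ x) →
        (∀ (x : V) (σ τ : V → S), (∀ v, v ≠ x → σ v = τ v) → |f σ - f τ| ≤ δ x * r (σ x) (τ x)) →
          |∫ σ, f σ ∂(γ (win c) ω) - ∫ σ, f σ ∂(γ (win c) η)| ≤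
            (∑ x ∈ win c, K c y x * δ x) * r (ω y) (η y))
    (hloc : ∀ (c : V) (ζ ζ' : V → S), (∀ v ∈ nbhd c, ζ v = ζ' v) →
      ∀ (f : (V → S) → ℝ), Measurable f → (∃ B, ∀ σ, |f σ| ≤ B) → DependsOn f (win c : Set V) →
        ∫ σ, f σ ∂(γ (win c) ζ) = ∫ σ, f σ ∂(γ (win c) ζ'))
    {W : Set V} [DecidablePred (· ∈ W)] (hself : ∀ c, c ∈ W → c ∈ win c)
    (cover : V → Finset V) (hcover : ∀ c x, x ∈ win c ↔ c ∈ cover x)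
    {γ₀ Γ : ℝ} (hγ₀ : 0 ≤ γ₀) (hγ₁ : γ₀ < 1) (hΓ : 0 ≤ Γ)
    (hsum0 : ∀ x, ∑ c ∈ cover x, ∑ y ∈ (nbhd c).filter (· ∈ W), K c y x ≤ Γ)
    (hsum : ∀ x, ∑ c ∈ cover x, ∑ y ∈ (nbhd c).filter (· ∈ W), K c y x ≤ γ₀ * (cover x).card)
    (hexh : ∀ (Δ : Finset V), (↑Δ : Set V) ⊆ W → ∀ (L₀ : ℕ), ∃ (Λ : Finset V) (ℓ : V → ℕ),
      Δ ⊆ Λ ∧ (↑Λ : Set V) ⊆ W ∧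
      (∀ x, ℓ x ≠ 0 → ∀ c, x ∈ win c → c ∈ Λ ∧ win c ⊆ Λ ∧ ∀ v ∈ nbhd c, v ∉ Λ → v ∉ W) ∧
      (∀ c x y, x ∈ win c → K c y x ≠ 0 → ℓ x ≤ ℓ y + 1) ∧ (∀ x ∈ Δ, L₀ ≤ ℓ x))
    (ζ : V → S) {μ ν : Measure (V → S)} [IsProbabilityMeasure μ] [IsProbabilityMeasure ν]
    (hμζ : ∀ᵐ σ ∂μ, ∀ z ∉ W, σ z = ζ z) (hνζ : ∀ᵐ σ ∂ν, ∀ z ∉ W, σ z = ζ z)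
    (hμ : ∀ Λ : Finset V, (↑Λ : Set V) ⊆ W →
      ∀ A : Set (V → S), MeasurableSet A → ∫⁻ η, γ Λ η A ∂μ = μ A)
    (hν : ∀ Λ : Finset V, (↑Λ : Set V) ⊆ W →
      ∀ A : Set (V → S), MeasurableSet A → ∫⁻ η, γ Λ η A ∂ν = ν A)
    {F : (V → S) → ℝ} (hFm : Measurable F) {B : ℝ} (hB : ∀ σ, |F σ| ≤ B) {Δ : Finset V}
    (hFdep : DependsOn F (Δ : Set V)) {δ : V → ℝ} (hδ : IsLipBound r F δ) :
    ∫ σ, F σ ∂μ = ∫ σ, F σ ∂ν := by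
  -- adapted from `DobrushinShlosman.integral_eq_integral_of_window` (DLR on `W` only; a.e. frozen exterior)
  classical
  haveI : IsProbabilityMeasure μ := inferInstance
  set κ₁ : ℝ := (1 - γ₀) ^ 2 / (2 * (2 * Γ + 1)) with hκ₁
  have hκ₁pos : 0 < κ₁ := by
    have h1 : 0 < 1 - γ₀ := sub_pos.2 hγ₁
    rw [hκ₁]; positivity
  -- freeze the exterior coordinates of `F` to `ζ` (changes nothing almost surely)
  set fr : (V → S) → (V → S) := fun σ v => if v ∈ W then σ v else ζ v with hfr
  have hfrm : Measurable fr := by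
    refine measurable_pi_lambda _ fun v => ?_
    by_cases hv : v ∈ W
    · simp only [hfr, if_pos hv]; exact measurable_pi_apply v
    · simp only [hfr, if_neg hv]; exact measurable_const
  have hfr_of_eq : ∀ σ : V → S, (∀ z ∉ W, σ z = ζ z) → fr σ = σ := fun σ hσ => by
    funext v
    by_cases hv : v ∈ W
    · simp only [hfr, if_pos hv]
    · simp only [hfr, if_neg hv]; exact (hσ v hv).symm
  set F' : (V → S) → ℝ := fun σ => F (fr σ) with hF'
  have hF'm : Measurable F' := hFm.comp hfrm
  have hF'B : ∀ σ, |F' σ| ≤ B := fun σ => hB _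
  set Δ' : Finset V := Δ.filter (· ∈ W) with hΔ'
  have hΔ'W : (↑Δ' : Set V) ⊆ W := fun v hv => (Finset.mem_filter.1 (Finset.mem_coe.1 hv)).2
  have hF'dep : DependsOn F' (Δ' : Set V) := by
    intro σ σ' hσ
    simp only [hF']
    refine hFdep fun v hv => ?_
    by_cases hvW : v ∈ W
    · simp only [hfr, if_pos hvW]
      exact hσ v (Finset.mem_coe.2 (Finset.mem_filter.2 ⟨Finset.mem_coe.1 hv, hvW⟩))
    · simp only [hfr, if_neg hvW]
  have hF'lip : IsLipBound r F' δ := by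
    refine ⟨hδ.nonneg, fun y σ τ hστ => ?_⟩
    by_cases hyW : y ∈ W
    · have h := hδ.le y (fr σ) (fr τ) fun z hz => by
        by_cases hzW : z ∈ W
        · simp only [hfr, if_pos hzW]; exact hστ z hz
        · simp only [hfr, if_neg hzW]
      have e1 : fr σ y = σ y := by simp only [hfr, if_pos hyW]
      have e2 : fr τ y = τ y := by simp only [hfr, if_pos hyW]
      simp only [hF']
      rw [e1, e2] at h
      exact h
    · have hfrστ : fr σ = fr τ := by
        funext z
        by_cases hzW : z ∈ W
        · simp only [hfr, if_pos hzW]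
          exact hστ z fun hzy => hyW (hzy ▸ hzW)
        · simp only [hfr, if_neg hzW]
      simp only [hF', hfrστ, sub_self, abs_zero]
      exact mul_nonneg (hδ.nonneg y) (hr0 _ _)
  have hμF : ∫ σ, F σ ∂μ = ∫ σ, F' σ ∂μ := by
    refine integral_congr_ae ?_
    filter_upwards [hμζ] with σ hσ
    simp only [hF', hfr_of_eq σ hσ]
  have hνF : ∫ σ, F σ ∂ν = ∫ σ, F' σ ∂ν := by
    refine integral_congr_ae ?_
    filter_upwards [hνζ] with σ hσ
    simp only [hF', hfr_of_eq σ hσ]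
  rw [hμF, hνF]
  -- the Lipschitz vector cut down to `Δ'`
  set δΔ : V → ℝ := fun x => if x ∈ Δ' then δ x else 0 with hδΔ
  have hδΔ' : IsLipBound r F' δΔ := hF'lip.restrict hF'dep
  set SΔ : ℝ := ∑ x ∈ Δ', δ x with hSΔ
  -- the bound at every depth
  have step : ∀ L₀ : ℕ, |∫ σ, F' σ ∂μ - ∫ σ, F' σ ∂ν| ≤ 2 * R * Real.exp (-(κ₁ * L₀)) * SΔ := by
    intro L₀
    obtain ⟨Λ, ℓ, hΔΛ, hΛW, hUΛ, hℓΛ, hLΛ⟩ := hexh Δ' hΔ'W L₀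
    have hFdepΛ : DependsOn F' (Λ : Set V) :=
      hF'dep.mono fun v hv => Finset.mem_coe.2 (hΔΛ (Finset.mem_coe.1 hv))
    have hδL : ∀ x, ℓ x < L₀ → δΔ x = 0 := fun x hx => by
      simp only [hδΔ]
      split_ifs with hxΔ
      · exact absurd (hLΛ x hxΔ) (not_le.2 hx)
      · rfl
    -- the two-boundary-condition bound, for boundary conditions frozen to `ζ` off `W`
    have hpair : ∀ ω η : V → S, (∀ z ∉ W, ω z = ζ z) → (∀ z ∉ W, η z = ζ z) →
        |∫ σ, F' σ ∂(γ Λ ω) - ∫ σ, F' σ ∂(γ Λ η)| ≤ 2 * R * Real.exp (-(κ₁ * L₀)) * SΔ := by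
      intro ω η hω hη
      have hU' : ∀ x, ℓ x ≠ 0 → ∀ c, x ∈ win c →
          c ∈ Λ ∧ win c ⊆ Λ ∧ ∀ v ∈ nbhd c, v ∉ Λ → ω v = η v := by
        intro x hx c hxc
        obtain ⟨h1, h2, h3⟩ := hUΛ x hx c hxc
        exact ⟨h1, h2, fun v hv hvΛ => by rw [hω v (h3 v hv hvΛ), hη v (h3 v hv hvΛ)]⟩
      have h := abs_integral_sub_integral_le_of_window_bulk hγ hr0 hrR hR hK0 hKsupp
        hcontract hloc W cover hcover hγ₀ hγ₁ hΓ hsum0 hsum Λ hΛW (fun c hc => hself c (hΛW hc))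
        ω η ℓ L₀ hU' hℓΛ hF'm hF'B hFdepΛ hδΔ' hδL
      have hs : ∑ x ∈ Λ, δΔ x = SΔ := by
        rw [hSΔ, hδΔ, Finset.sum_ite_mem, Finset.inter_eq_right.2 hΔΛ]
      rw [hs] at h
      exact h
    -- DLR on `Λ ⊆ W`: `μ F' = ∫ γ_Λ F' dμ`, `ν F' = ∫ γ_Λ F' dν`
    rw [← integral_integral_eq_of_dlr' hγ Λ (hμ Λ hΛW) (integrable_of_abs_le' hF'm hF'B),
      ← integral_integral_eq_of_dlr' hγ Λ (hν Λ hΛW) (integrable_of_abs_le' hF'm hF'B)]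
    exact abs_integral_sub_integral_le_of_osc_ae (measurable_windowAvg' hγ Λ hF'm)
      (fun σ => abs_windowAvg_le' hγ Λ hF'B σ) hμζ hνζ fun ω η hω hη => hpair ω η hω hη
  -- let the depth tend to infinity
  have hlim : Filter.Tendsto (fun L₀ : ℕ => 2 * R * Real.exp (-(κ₁ * L₀)) * SΔ) Filter.atTop
      (nhds (2 * R * 0 * SΔ)) := by
    refine ((tendsto_const_nhds.mul ?_).mul tendsto_const_nhds)
    have h1 : Filter.Tendsto (fun L₀ : ℕ => κ₁ * (L₀ : ℝ)) Filter.atTop Filter.atTop :=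
      Filter.Tendsto.const_mul_atTop hκ₁pos tendsto_natCast_atTop_atTop
    exact Real.tendsto_exp_neg_atTop_nhds_zero.comp h1
  rw [mul_zero, zero_mul] at hlim
  have h0 : |∫ σ, F' σ ∂μ - ∫ σ, F' σ ∂ν| ≤ 0 :=
    ge_of_tendsto hlim (Filter.Eventually.of_forall step)
  have := abs_nonneg (∫ σ, F' σ ∂μ - ∫ σ, F' σ ∂ν)
  exact sub_eq_zero.1 (abs_eq_zero.1 (le_antisymm h0 this))

section Determine

variable {M : Type*} [PseudoMetricSpace M] [MeasurableSpace M] [BorelSpace M]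

/-- ★ **Uniqueness of the solution of the DLR system on a region with frozen exterior, under the averaged
Dobrushin–Shlosman window condition** (Dobrushin–Shlosman 1985 Thm. 1 — `C_V` implies uniqueness — in
Georgii's «no phase transition in a subvolume» form, Thm. 8.20; Vasserstein form for an arbitrary measurable
spin space whose σ-algebra is induced by a map `val` into a metric space with `dist ∘ val ≤ A · r`, so that
bounded local `r`-Lipschitz observables determine probability measures). Hypotheses as in
`integral_eq_of_frozen_dlr_window_bulk`; conclusion `μ = ν`. [cite: DobrushinShlosman1985, Theorem 1] -/
theorem measure_eq_of_frozen_dlr_window_bulk [DecidableEq V] {γ : Specification V S}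
    (hγ : IsSpecification γ)
    {r : S → S → ℝ} {R : ℝ} (hr0 : ∀ a b, 0 ≤ r a b) (hrR : ∀ a b, r a b ≤ R) (hR : 0 ≤ R)
    {win nbhd : V → Finset V} {K : V → V → V → ℝ} (hK0 : ∀ c y x, 0 ≤ K c y x)
    (hKsupp : ∀ c y x, K c y x ≠ 0 → y ∈ nbhd c)
    (hcontract : ∀ (c y : V), y ∉ win c → ∀ (ω η : V → S), (∀ v, v ≠ y → ω v = η v) →
      ∀ (f : (V → S) → ℝ) (δ : V → ℝ), Measurable f → (∃ B, ∀ σ, |f σ| ≤ B) →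
        DependsOn f (win c : Set V) → (∀ x, 0 ≤ δ x) →
        (∀ (x : V) (σ τ : V → S), (∀ v, v ≠ x → σ v = τ v) → |f σ - f τ| ≤ δ x * r (σ x) (τ x)) →
          |∫ σ, f σ ∂(γ (win c) ω) - ∫ σ, f σ ∂(γ (win c) η)| ≤
            (∑ x ∈ win c, K c y x * δ x) * r (ω y) (η y))
    (hloc : ∀ (c : V) (ζ ζ' : V → S), (∀ v ∈ nbhd c, ζ v = ζ' v) →
      ∀ (f : (V → S) → ℝ), Measurable f → (∃ B, ∀ σ, |f σ| ≤ B) → DependsOn f (win c : Set V) →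
        ∫ σ, f σ ∂(γ (win c) ζ) = ∫ σ, f σ ∂(γ (win c) ζ'))
    {W : Set V} [DecidablePred (· ∈ W)] (hself : ∀ c, c ∈ W → c ∈ win c)
    (cover : V → Finset V) (hcover : ∀ c x, x ∈ win c ↔ c ∈ cover x)
    {γ₀ Γ : ℝ} (hγ₀ : 0 ≤ γ₀) (hγ₁ : γ₀ < 1) (hΓ : 0 ≤ Γ)
    (hsum0 : ∀ x, ∑ c ∈ cover x, ∑ y ∈ (nbhd c).filter (· ∈ W), K c y x ≤ Γ)
    (hsum : ∀ x, ∑ c ∈ cover x, ∑ y ∈ (nbhd c).filter (· ∈ W), K c y x ≤ γ₀ * (cover x).card)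
    (hexh : ∀ (Δ : Finset V), (↑Δ : Set V) ⊆ W → ∀ (L₀ : ℕ), ∃ (Λ : Finset V) (ℓ : V → ℕ),
      Δ ⊆ Λ ∧ (↑Λ : Set V) ⊆ W ∧
      (∀ x, ℓ x ≠ 0 → ∀ c, x ∈ win c → c ∈ Λ ∧ win c ⊆ Λ ∧ ∀ v ∈ nbhd c, v ∉ Λ → v ∉ W) ∧
      (∀ c x y, x ∈ win c → K c y x ≠ 0 → ℓ x ≤ ℓ y + 1) ∧ (∀ x ∈ Δ, L₀ ≤ ℓ x))
    (val : S → M) (hS : ‹MeasurableSpace S› = MeasurableSpace.comap val ‹MeasurableSpace M›)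
    {A : ℝ} (hA0 : 0 ≤ A) (hA : ∀ a b, dist (val a) (val b) ≤ A * r a b)
    (ζ : V → S) {μ ν : Measure (V → S)} [IsProbabilityMeasure μ] [IsProbabilityMeasure ν]
    (hμζ : ∀ᵐ σ ∂μ, ∀ z ∉ W, σ z = ζ z) (hνζ : ∀ᵐ σ ∂ν, ∀ z ∉ W, σ z = ζ z)
    (hμ : ∀ Λ : Finset V, (↑Λ : Set V) ⊆ W →
      ∀ A : Set (V → S), MeasurableSet A → ∫⁻ η, γ Λ η A ∂μ = μ A)
    (hν : ∀ Λ : Finset V, (↑Λ : Set V) ⊆ W →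
      ∀ A : Set (V → S), MeasurableSet A → ∫⁻ η, γ Λ η A ∂ν = ν A) :
    μ = ν := by
  refine measure_eq_of_forall_integral_eq_of_isLipBound val hS fun f Δ δ hfm hdep hf1 hδ => ?_
  -- an `A δ`-Lipschitz bound for the weight `r` (as in `subsingleton_gibbsMeasures_of_window`)
  have hδ' : IsLipBound r f fun y => A * δ y :=
    ⟨fun y => mul_nonneg hA0 (hδ.nonneg y), fun y σ τ hστ =>
      (hδ.le y σ τ hστ).trans (by
        calc δ y * dist (val (σ y)) (val (τ y)) ≤ δ y * (A * r (σ y) (τ y)) :=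
              mul_le_mul_of_nonneg_left (hA _ _) (hδ.nonneg y)
          _ = A * δ y * r (σ y) (τ y) := by ring)⟩
  exact integral_eq_of_frozen_dlr_window_bulk hγ hr0 hrR hR hK0 hKsupp hcontract hloc hself cover hcover
    hγ₀ hγ₁ hΓ hsum0 hsum hexh ζ hμζ hνζ hμ hν hfm hf1 hdep hδ'

end Determine

end Literature.Probability.LatticeModels.DobrushinShlosman

end
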